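import Summits.Schanuel.Schanuel.Theorems.RootDecomp1KXLinear03

/-!
# RootDecomp1KXLinear — lens 1, generation 45, node 2 (g45b) «X-LINEAR THIN FIBRE: ALL CURVES A(Y) + x·B(Y) WITH deg B < deg A, HYPOTHESIS-FREE» (RULE K-R31 (ii) second clause + K-R32 (i); CLAIM L2261, ACK/CHECKLIST K-g45b L2262, NODE L2274 / REQUEST L2275, critic VERDICT L2278: CLEARED — THEOREM ×2; port shape L2282 (d)) — continuation (RootDecomp1KXLinear04): §X part 3 — levels_finite → thinFibreAt_xLinP; common rational roots

(lens-1 g45b HOME kernel K₂ = HOME/decomp-schanuel-lens-1/g45b/DLxlinear.lean db54a0a5…, 3838 l = the DegreeLadder ed. 3 prefix (tree: RootDecomp1KDegreeLadder01–09) + `XLinearCore` (l.2184–2562) + §X (l.2564–3836); imports SkelCell01 + Literature RidoutIntegers (BUILT on the farm since 20:13Z). Port by census-1 gen 19 as `RootDecomp1KXLinear01`–`05`: 01 = XLinearCore (namespace `…RootDecomp1KXLinearCore`; the 2-adic CORE LEMMA `core` — second-order approximation of the nearest e-th root by the rationally shifted point — `roots_structure`, and Step 5 `ridout_step` with `Ridout.padicRoth_int`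 BY TREE NAME; imports tree DegreeLadder08 + Literature RidoutIntegers); 02–05 = §X (namespace `…RootDecomp1KXLinear`): 02 = `xLinP`, `gap`, level points `OnLevel`, Steps 1a/1b/2/6, 2-adic infrastructure (first half); 03 = 2-adic infrastructure (second half: the shifted integer, valuation bookkeeping); 04 = the composition `levels_finite` → `thinFibreAt_xLinP` (scoped `maxHeartbeats 800000` ×2 as in K) + common rational roots; 05 = pole gap e = 1 `thinFibreAt_xLinP_gapOne` (no Ridout), `thinFibreAt_xLinear`, `thinFibreAt_xLinear_of_lt`, the typed classes `XLinearGap2` / `XLinearLt` with `thinFibreAt_of_xLinearGap2` / `thinFibreAt_of_xLinearLt` / `thinFibreAt_sqMulP'` (all c ≠ 0), positions and non-members (`not_xLinearGap2_lineP`, `cuspP`), the consumer `xLinear_nonvanishing (hm : 2 ≤ m) (hρ : SkelLiouvilleFix m ρ) (A B) (hB : B ≠ 0) (hlt : B.natDegree < A.natDegree) : aeval ρ A + liouvilleNumber 2 * aeval ρ B ≠ 0` — ALL HYPOTHESIS-FREE.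
PORT EDITS (critic L2282 (d)): the DegreeLadder prefix dropped (tree parts imported); the `(hR : PadicRothInt)` binder REMOVED from the ten decls that carried it and `Literature.NumberTheory.DiophantineApproximation.Ridout.padicRoth_int` fed directly at the one use site in `ridout_step`; the §HypFree primed twins and `padicRothInt_holds` DROPPED (the unprimed names now denote the binder-free forms); `open …DegreeLadder (PadicRothInt pTwo)` ↦ `(pTwo)`; two linter options dropped; 22 one-line docstrings added; seven generic p-adic/arithmetic helpers private (`norm_natCast_le_one`, `norm_two`, `norm_two_pow`, `norm_intCast_le_one'`, `factorial_sub_ge`, `natDegree_linear`, `den_dvd_leadingCoeff` — dedup-safety vs DegreeLadder08's private 2-adic lemmas) with per-part private copies, plus private copies of the DegreeLadder port's private ℓ₂/psNumer lemmas where §X uses them; statements and proofs otherwise verbatim. `--supports stmt-Schanuel-33364`; no census credit carried; rung 0 — nothing here proves Schanuel; `ThinFibre m₀` (all curves) stays OPEN / IDEA-NEEDED.)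
-/

noncomputable section

namespace Summit.Schanuel.Schanuel.Theorems.RootDecomp1KXLinear

open Polynomial LiouvilleNumber
open scoped Nat
open Summit.Schanuel.Schanuel.Theorems.RootDecomp1KSkelCell
  (exists_le_two_pow_factorial iota iota_spec iota_le_of_le pow_lt_of_lt_iota lt_iota_of_pow_lt iota_mono
   one_le_iota SkelLiouville SkelLiouvilleFix skelLiouville_iff_fix SkelLiouvilleFix.mono uStar dU rU dU_cast
   two_pow_le_four_mul_dU two_mul_dU_lt one_le_dU rU_den rU_cast uStar_sub_rU skelLiouvilleFix_one_uStar
   not_skelFixOne_algebraicIndependent)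
open Summit.Schanuel.Schanuel.Theorems.RootDecomp1KTwoBaseCell (psNumer partialSum_eq_psNumer_div coprime_psNumer
  algebraicIndependent_of_forall_int')
open Summit.Schanuel.Schanuel.Theorems.RootDecomp1KRelLiouvilleCell (partialSum_two_strictMono
  partialSum_two_lt_liouvilleNumber abs_liouvilleNumber_two_sub_partialSum)
open Summit.Schanuel.Schanuel.Theorems.RootDecomp1KDegreeLadder
open Summit.Schanuel.Schanuel.Theorems.RootDecomp1KXLinearCore (core ridout_step)

/-- `s_N = p_N / 2^{N!}` (tree `partialSum_eq_psNumer_div` at `b = 2`). -/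
private theorem partialSum_two (N : ℕ) : partialSum 2 N = (psNumer 2 N : ℝ) / (2 : ℝ) ^ N ! := by
  have := partialSum_eq_psNumer_div (b := 2) (by norm_num) N
  simpa using this

/-- `0 < p_N`. -/
private theorem psNumer_pos (N : ℕ) : 0 < psNumer 2 N := by
  unfold psNumer
  exact Finset.sum_pos (fun i _ => pow_pos two_pos _) (Finset.nonempty_range_iff.mpr (Nat.succ_ne_zero N))

/-- `‖(z : \overline{ℚ₂})‖ ≤ 1` for integers. -/
private theorem norm_intCast_le_one' (z : ℤ) : ‖(z : PadicAlgCl 2)‖ ≤ 1 := by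
  have h1 : (z : PadicAlgCl 2) = algebraMap ℚ_[2] (PadicAlgCl 2) (z : ℚ_[2]) := (map_intCast _ z).symm
  rw [h1, PadicAlgCl.norm_extends]
  exact Padic.norm_int_le_one z

/-! ### The composition (PROVED): finitely many levels carry a bounded point, hence the clause. -/

/-- `2 ≤ gap A B` under the pole-gap hypothesis. -/
theorem gap_pos {A B : ℤ[X]} (he : B.natDegree + 2 ≤ A.natDegree) : 2 ≤ gap A B := by
  unfold gap; omega

/-- `L = lc A · den θ`: `Z = L·2^t·(r + θ)` is an integer at every point. -/
def ell (A B : ℤ[X]) : ℤ := A.leadingCoeff * (theta A B).den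

/-- At a level point, `B(r) ≠ 0` (no common rational root). -/
theorem onLevel_B_ne_zero {A B : ℤ[X]} (hAB : ∀ r : ℚ, aeval r A = 0 → aeval r B = 0 → False)
    {N : ℕ} {r : ℚ} (h : OnLevel A B N r) : aeval r B ≠ 0 := by
  intro hb0
  apply hAB r _ hb0
  simpa [OnLevel, hb0] using h

/-- At a level point, `A(r) ≠ 0` (no common rational root). -/
theorem onLevel_A_ne_zero {A B : ℤ[X]} (hAB : ∀ r : ℚ, aeval r A = 0 → aeval r B = 0 → False)
    {N : ℕ} {r : ℚ} (h : OnLevel A B N r) : aeval r A ≠ 0 := by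
  intro ha0
  apply hAB r ha0
  have h1 : (psNumer 2 N : ℚ) / 2 ^ N ! * aeval r B = 0 := by simpa [OnLevel, ha0] using h
  have h2 : (psNumer 2 N : ℚ) / 2 ^ N ! ≠ 0 := by
    have := psNumer_pos N
    positivity
  exact (mul_eq_zero.mp h1).resolve_left h2

/-- Each rational `r` lies on finitely many (in fact at most one) levels. -/
theorem levels_of_point_finite {A B : ℤ[X]} (hAB : ∀ r : ℚ, aeval r A = 0 → aeval r B = 0 → False)
    (r : ℚ) : {N : ℕ | OnLevel A B N r}.Finite := by
  by_cases hBr : aeval r B = 0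
  · apply Set.Finite.subset Set.finite_empty
    intro N hN
    exact (onLevel_B_ne_zero hAB hN hBr).elim
  apply Set.Subsingleton.finite
  intro N hN N' hN'
  have h1 : (psNumer 2 N : ℚ) / 2 ^ N ! = (psNumer 2 N' : ℚ) / 2 ^ N' ! := by
    have e1 : aeval r A + (psNumer 2 N : ℚ) / 2 ^ N ! * aeval r B = 0 := hN
    have e2 : aeval r A + (psNumer 2 N' : ℚ) / 2 ^ N' ! * aeval r B = 0 := hN'
    have : (psNumer 2 N : ℚ) / 2 ^ N ! * aeval r B = (psNumer 2 N' : ℚ) / 2 ^ N' ! * aeval r B := by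
      linarith
    exact mul_right_cancel₀ hBr this
  have h2 : partialSum 2 N = partialSum 2 N' := by
    rw [partialSum_two, partialSum_two]
    have := congrArg (Rat.cast : ℚ → ℝ) h1
    push_cast at this
    exact this
  exact partialSum_two_strictMono.injective h2

/-- The points with small 2-adic denominator exponent lie in a finite set of rationals. -/
theorem small_points_finite (a : ℤ) (ha : a ≠ 0) (C : ℝ) (T : ℕ) :
    {r : ℚ | |(r : ℝ)| ≤ C ∧ (r.den : ℤ) ∣ a * 2 ^ padicValNat 2 r.den ∧ padicValNat 2 r.den ≤ T}.Finite := by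
  classical
  set D : ℕ := a.natAbs * 2 ^ T with hD
  obtain ⟨K, hK⟩ : ∃ K : ℕ, |C| * D ≤ K := exists_nat_ge _
  apply Set.Finite.subset (((Set.finite_Icc (-(K : ℤ)) K).prod (Set.finite_Icc (0 : ℕ) D)).image
    (fun p : ℤ × ℕ => (p.1 : ℚ) / p.2))
  rintro r ⟨hrC, hdvd, hT⟩
  have hden : r.den ≤ D := by
    have h1 : r.den ∣ (a * 2 ^ padicValNat 2 r.den).natAbs := by
      have := Int.natAbs_dvd_natAbs.mpr hdvd
      simpa using this
    have h2 : (a * 2 ^ padicValNat 2 r.den).natAbs ≤ D := by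
      rw [Int.natAbs_mul, Int.natAbs_pow]
      exact Nat.mul_le_mul_left _ (Nat.pow_le_pow_right (by norm_num) hT)
    exact (Nat.le_of_dvd (Int.natAbs_pos.mpr (mul_ne_zero ha (pow_ne_zero _ two_ne_zero))) h1).trans h2
  have hnum : |(r.num : ℝ)| ≤ K := by
    have e1 : (r.num : ℝ) = (r : ℝ) * r.den := by
      have := Rat.mul_den_eq_num r
      exact_mod_cast this.symm
    rw [e1, abs_mul]
    have hC : 0 ≤ C := (abs_nonneg _).trans hrC
    calc |(r : ℝ)| * |(r.den : ℝ)| ≤ C * D := by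
          rw [abs_of_nonneg (by positivity : (0 : ℝ) ≤ r.den)]
          exact mul_le_mul hrC (by exact_mod_cast hden) (by positivity) hC
      _ ≤ |C| * D := by gcongr; exact le_abs_self C
      _ ≤ K := hK
  refine ⟨(r.num, r.den), ⟨⟨?_, ?_⟩, ⟨Nat.zero_le _, hden⟩⟩, Rat.num_div_den r⟩
  · have : (-(K : ℝ)) ≤ r.num := (abs_le.mp hnum).1
    exact_mod_cast this
  · have : (r.num : ℝ) ≤ K := (abs_le.mp hnum).2
    exact_mod_cast this

/-- arithmetic of the precision exponent: `e·t = N! + κ`, `e ≥ 2`, `N ≥ 5`, `3κ + 1 ≤ N` give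
`3t ≤ 2·(N! − (N−1)!)`, i.e. `2^{−(N!−(N−1)!)} ≤ (2^{−t})^{3/2}`. -/
theorem prec_helper {N e t : ℕ} {κ : ℤ} (hN : 5 ≤ N) (hκ : 3 * κ + 1 ≤ (N : ℤ)) (he : 2 ≤ e)
    (h : ((e * t : ℕ) : ℤ) = ((N ! : ℕ) : ℤ) + κ) : 3 * t ≤ 2 * ((N)! - (N - 1)!) := by
  obtain ⟨n, rfl⟩ : ∃ n, N = n + 1 := ⟨N - 1, by omega⟩
  have hn4 : 4 ≤ n := by omega
  have hsub : (n + 1)! - (n + 1 - 1)! = n * n ! := by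
    rw [Nat.add_sub_cancel, Nat.factorial_succ, Nat.succ_mul, Nat.add_sub_cancel]
  rw [hsub]
  have hFn : n ≤ n ! := Nat.self_le_factorial n
  have hF : (((n + 1)! : ℕ) : ℤ) = ((n : ℤ) + 1) * (n ! : ℕ) := by
    rw [Nat.factorial_succ]; push_cast; ring
  rw [hF] at h
  push_cast at h hκ
  have ht0 : (0 : ℤ) ≤ t := by positivity
  have hf0 : (0 : ℤ) ≤ (n ! : ℕ) := by positivity
  have h2t : (2 : ℤ) * t ≤ e * t := by nlinarith
  zify at hFn hn4 ⊢
  nlinarith [mul_le_mul_of_nonneg_right hn4 hf0, mul_le_mul_of_nonneg_right hFn (by norm_num : (0:ℤ) ≤ 3)]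

/-- `N ≤ N! − (N−1)!` for `N ≥ 3`. -/
private theorem factorial_sub_ge {N : ℕ} (hN : 3 ≤ N) : N ≤ (N)! - (N - 1)! := by
  obtain ⟨n, rfl⟩ : ∃ n, N = n + 1 := ⟨N - 1, by omega⟩
  have hsub : (n + 1)! - (n + 1 - 1)! = n * n ! := by
    rw [Nat.add_sub_cancel, Nat.factorial_succ, Nat.succ_mul, Nat.add_sub_cancel]
  rw [hsub]
  have h2 : 2 ≤ n ! := (show 2 ≤ n by omega).trans (Nat.self_le_factorial n)
  nlinarith

set_option maxHeartbeats 800000 in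
/-- **Per-point Ridout data** (Steps 1–5 combined): at a large level `N`, a point `r` with large `t = v₂(den r)` yields an
INTEGER `Z = L·2^t·(r + θ)` of size `≤ C₀·2^t` lying within `C₁·(2^{−t})^{3/2}` of `L·ζ` for an `e`-th root `ζ` of `γ`. -/
theorem point_data (A B : ℤ[X]) (hB : B ≠ 0) (he : B.natDegree + 2 ≤ A.natDegree)
    (hAB : ∀ r : ℚ, aeval r A = 0 → aeval r B = 0 → False) (C : ℝ) :
    ∃ (Tst Nst : ℕ) (C₀ C₁ : ℝ), 0 < C₀ ∧ 0 < C₁ ∧ tee0 A B ≤ Tst ∧ 2 ≤ Nst ∧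
      ∀ N, Nst ≤ N → ∀ r : ℚ, |(r : ℝ)| ≤ C → OnLevel A B N r → Tst < padicValNat 2 r.den →
        ∃ Z : ℤ, (Z : ℚ) = ell A B * 2 ^ padicValNat 2 r.den * (r + theta A B) ∧
          |(Z : ℝ)| ≤ C₀ * 2 ^ padicValNat 2 r.den ∧
          ∃ ζ : PadicAlgCl 2, ζ ^ gap A B = (gam A B : PadicAlgCl 2) ∧
            ‖(Z : PadicAlgCl 2) - (ell A B : PadicAlgCl 2) * ζ‖
              ≤ C₁ * ((1 / 2 : ℝ) ^ padicValNat 2 r.den) ^ (3 / 2 : ℝ) := by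
  classical
  have he2 : 2 ≤ gap A B := gap_pos he
  have hA0 : A ≠ 0 := by rintro rfl; simp at he
  have ha : A.leadingCoeff ≠ 0 := leadingCoeff_ne_zero.mpr hA0
  have hb : B.leadingCoeff ≠ 0 := leadingCoeff_ne_zero.mpr hB
  have hdeg : B.natDegree < A.natDegree := by omega
  obtain ⟨M, hM, hexp⟩ := expansion_bound A B he
  have haK : (A.leadingCoeff : PadicAlgCl 2) ≠ 0 := by exact_mod_cast ha
  have hγ1 := norm_gam A B ha hb
  obtain ⟨Cc, hCc, hcore⟩ := core (gap A B) (by omega) (A.leadingCoeff : PadicAlgCl 2)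
    (gam A B : PadicAlgCl 2) (cee1 A : PadicAlgCl 2) (cee2 A B : PadicAlgCl 2) haK hγ1
  obtain ⟨T₁, hT₁⟩ := exists_pow_lt_of_lt_one (show (0 : ℝ) < 1 / (2 * M) by positivity)
    (show (1 / 4 : ℝ) < 1 by norm_num)
  obtain ⟨N₁, hN₁⟩ := exists_pow_lt_of_lt_one (show (0 : ℝ) < 1 / (2 * M) by positivity)
    (show (1 / 2 : ℝ) < 1 by norm_num)
  refine ⟨max (tee0 A B) T₁, max 5 (max N₁ (3 * (kap A B).toNat + 1)),
    |(ell A B : ℝ)| * (|C| + |(theta A B : ℝ)|) + 1, Cc * (2 * M + 1), by positivity, by positivity,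
    le_max_left _ _, le_trans (by norm_num) (le_max_left _ _), ?_⟩
  intro N hN r hrC hpt hTt
  have hN5 : 5 ≤ N := le_trans (le_max_left _ _) hN
  have hNN₁ : N₁ ≤ N := le_trans ((le_max_left _ _).trans (le_max_right _ _)) hN
  have hNκ : 3 * (kap A B).toNat + 1 ≤ N := le_trans ((le_max_right _ _).trans (le_max_right _ _)) hN
  have hN2 : 2 ≤ N := by omega
  have ht0 : tee0 A B < padicValNat 2 r.den := lt_of_le_of_lt (le_max_left _ _) hTt
  have htT₁ : T₁ < padicValNat 2 r.den := lt_of_le_of_lt (le_max_right _ _) hTt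
  set t := padicValNat 2 r.den with ht_def
  have hBr := onLevel_B_ne_zero hAB hpt
  have hAr := onLevel_A_ne_zero hAB hpt
  obtain ⟨hu1, hΦ⟩ := hexp hN2 hpt hAr hBr ht0
  have hval := val_relation A B hdeg hN2 hpt hAr hBr ht0
  obtain ⟨k, hk⟩ := den_dvd_lc_two_pow A B hdeg hpt
  -- the defect `δ ≤ 1`
  have hE : N ≤ (N)! - (N - 1)! := factorial_sub_ge (by omega)
  have h14 : (1 / 4 : ℝ) ^ t ≤ 1 / (2 * M) :=
    (pow_le_pow_of_le_one (by norm_num) (by norm_num) htT₁.le).trans hT₁.le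
  have h12 : (1 / 2 : ℝ) ^ ((N)! - (N - 1)!) ≤ 1 / (2 * M) :=
    ((pow_le_pow_of_le_one (by norm_num) (by norm_num) hE).trans
      (pow_le_pow_of_le_one (by norm_num) (by norm_num) hNN₁)).trans hN₁.le
  set δ : ℝ := M * ((1 / 4 : ℝ) ^ t + (1 / 2 : ℝ) ^ ((N)! - (N - 1)!)) with hδ_def
  have hδ0 : 0 ≤ δ := by positivity
  have hδ1 : δ ≤ 1 :=
    calc δ ≤ M * (1 / (2 * M) + 1 / (2 * M)) := by rw [hδ_def]; gcongr
      _ = 1 := by field_simp; ring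
  -- Steps 3–4
  set u : PadicAlgCl 2 := ((((2 : ℚ) ^ t * r : ℚ)) : PadicAlgCl 2) with hu_def
  obtain ⟨ζ, hζe, hζ⟩ := hcore t δ hδ0 hδ1 u hu1 hΦ
  -- the integer `Z`
  set Z : ℤ := ((theta A B).den : ℤ) * (k * r.num) + A.leadingCoeff * 2 ^ t * (theta A B).num with hZ_def
  have h1 : (A.leadingCoeff : ℚ) * 2 ^ t * r = k * r.num := by
    have e1 : ((A.leadingCoeff * 2 ^ t : ℤ) : ℚ) = ((r.den * k : ℤ) : ℚ) := by rw [hk]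
    push_cast at e1
    calc (A.leadingCoeff : ℚ) * 2 ^ t * r = (r.den * k) * r := by rw [e1]
      _ = k * (r * r.den) := by ring
      _ = k * r.num := by rw [Rat.mul_den_eq_num]
  have h2 := Rat.mul_den_eq_num (theta A B)
  have hZQ : (Z : ℚ) = ell A B * 2 ^ t * (r + theta A B) := by
    rw [hZ_def, ell]
    push_cast
    linear_combination (-((theta A B).den : ℚ)) * h1 - (A.leadingCoeff : ℚ) * 2 ^ t * h2
  refine ⟨Z, hZQ, ?_, ζ, hζe, ?_⟩
  · -- archimedean size
    have hZR : (Z : ℝ) = (ell A B : ℝ) * 2 ^ t * ((r : ℝ) + (theta A B : ℝ)) := by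
      have := congrArg (Rat.cast : ℚ → ℝ) hZQ
      push_cast at this
      exact this
    rw [hZR, abs_mul, abs_mul, abs_of_pos (by positivity : (0 : ℝ) < 2 ^ t)]
    have hr' : |(r : ℝ)| ≤ |C| := hrC.trans (le_abs_self C)
    have hsum : |(r : ℝ) + (theta A B : ℝ)| ≤ |C| + |(theta A B : ℝ)| := (abs_add_le _ _).trans (by linarith)
    calc |(ell A B : ℝ)| * 2 ^ t * |(r : ℝ) + (theta A B : ℝ)|
        ≤ |(ell A B : ℝ)| * 2 ^ t * (|C| + |(theta A B : ℝ)|) := by gcongr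
      _ = (|(ell A B : ℝ)| * (|C| + |(theta A B : ℝ)|)) * 2 ^ t := by ring
      _ ≤ (|(ell A B : ℝ)| * (|C| + |(theta A B : ℝ)|) + 1) * 2 ^ t := by gcongr; linarith
  · -- 2-adic closeness, precision exponent 3/2
    have hθK : (theta A B : PadicAlgCl 2) = ((cee1 A : PadicAlgCl 2) * (gam A B : PadicAlgCl 2) +
        (cee2 A B : PadicAlgCl 2)) / ((A.leadingCoeff : PadicAlgCl 2) * (gap A B : ℕ) * (gam A B : PadicAlgCl 2)) := by
      rw [theta]; push_cast; rfl
    have hZK : (Z : PadicAlgCl 2) = (ell A B : PadicAlgCl 2) * (2 : PadicAlgCl 2) ^ t *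
        ((r : PadicAlgCl 2) + (theta A B : PadicAlgCl 2)) := by
      have := congrArg (Rat.cast : ℚ → PadicAlgCl 2) hZQ
      push_cast at this
      exact this
    have huK : u = (2 : PadicAlgCl 2) ^ t * (r : PadicAlgCl 2) := by rw [hu_def]; push_cast; rfl
    have hdiff : (Z : PadicAlgCl 2) - (ell A B : PadicAlgCl 2) * ζ = (ell A B : PadicAlgCl 2) *
        (u + (2 : PadicAlgCl 2) ^ t * (((cee1 A : PadicAlgCl 2) * (gam A B : PadicAlgCl 2) +
          (cee2 A B : PadicAlgCl 2)) / ((A.leadingCoeff : PadicAlgCl 2) * (gap A B : ℕ) * (gam A B : PadicAlgCl 2)))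
          - ζ) := by
      rw [hZK, huK, ← hθK]; ring
    rw [hdiff, norm_mul]
    have hL1 : ‖(ell A B : PadicAlgCl 2)‖ ≤ 1 := norm_intCast_le_one' _
    have hclose : ‖u + (2 : PadicAlgCl 2) ^ t * (((cee1 A : PadicAlgCl 2) * (gam A B : PadicAlgCl 2) +
          (cee2 A B : PadicAlgCl 2)) / ((A.leadingCoeff : PadicAlgCl 2) * (gap A B : ℕ) * (gam A B : PadicAlgCl 2)))
          - ζ‖ ≤ Cc * (δ + (1 / 4 : ℝ) ^ t) := hζ
    -- compare with `(2^{-t})^{3/2}`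
    set x : ℝ := (1 / 2 : ℝ) ^ t with hx_def
    have hx0 : 0 < x := by positivity
    have hx1 : x ≤ 1 := pow_le_one₀ (by norm_num) (by norm_num)
    have h41 : (1 / 4 : ℝ) ^ t ≤ x ^ (3 / 2 : ℝ) := by
      have e1 : (1 / 4 : ℝ) ^ t = x ^ (2 : ℝ) := by
        rw [hx_def, Real.rpow_two, ← pow_mul, show (1 / 4 : ℝ) = (1 / 2) ^ 2 by norm_num, ← pow_mul, mul_comm]
      rw [e1]
      exact Real.rpow_le_rpow_of_exponent_ge hx0 hx1 (by norm_num)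
    have h21 : (1 / 2 : ℝ) ^ ((N)! - (N - 1)!) ≤ x ^ (3 / 2 : ℝ) := by
      have hκle : 3 * kap A B + 1 ≤ (N : ℤ) := by
        have := Int.self_le_toNat (kap A B)
        omega
      have h3 := prec_helper hN5 hκle he2 hval
      have e1 : x ^ (3 / 2 : ℝ) = (1 / 2 : ℝ) ^ ((t : ℝ) * (3 / 2)) := by
        rw [hx_def, Real.rpow_mul (by norm_num), Real.rpow_natCast]
      have e2 : (1 / 2 : ℝ) ^ ((N)! - (N - 1)!) = (1 / 2 : ℝ) ^ ((((N)! - (N - 1)! : ℕ)) : ℝ) :=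
        (Real.rpow_natCast _ _).symm
      rw [e1, e2]
      apply Real.rpow_le_rpow_of_exponent_ge (by norm_num) (by norm_num)
      have : ((3 * t : ℕ) : ℝ) ≤ ((2 * ((N)! - (N - 1)!) : ℕ) : ℝ) := by exact_mod_cast h3
      push_cast at this
      linarith
    calc ‖(ell A B : PadicAlgCl 2)‖ * ‖u + (2 : PadicAlgCl 2) ^ t * (((cee1 A : PadicAlgCl 2) *
            (gam A B : PadicAlgCl 2) + (cee2 A B : PadicAlgCl 2)) /
            ((A.leadingCoeff : PadicAlgCl 2) * (gap A B : ℕ) * (gam A B : PadicAlgCl 2))) - ζ‖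
        ≤ 1 * (Cc * (δ + (1 / 4 : ℝ) ^ t)) := by gcongr
      _ = Cc * (M * ((1 / 4 : ℝ) ^ t + (1 / 2 : ℝ) ^ ((N)! - (N - 1)!)) + (1 / 4 : ℝ) ^ t) := by
          rw [one_mul, hδ_def]
      _ ≤ Cc * (M * (x ^ (3 / 2 : ℝ) + x ^ (3 / 2 : ℝ)) + x ^ (3 / 2 : ℝ)) := by gcongr
      _ = Cc * (2 * M + 1) * x ^ (3 / 2 : ℝ) := by ring

set_option maxHeartbeats 800000 in
/-- **Finitely many levels** (gap `e ≥ 2`, no common rational root) — PROVED. -/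
theorem levels_finite (A B : ℤ[X]) (hB : B ≠ 0) (he : B.natDegree + 2 ≤ A.natDegree)
    (hAB : ∀ r : ℚ, aeval r A = 0 → aeval r B = 0 → False) (C : ℝ) :
    {N : ℕ | ∃ r : ℚ, |(r : ℝ)| ≤ C ∧ bev (xLinP A B) (partialSum 2 N) r = 0}.Finite := by
  classical
  have he2 : 2 ≤ gap A B := gap_pos he
  have hA0 : A ≠ 0 := by rintro rfl; simp at he
  have ha : A.leadingCoeff ≠ 0 := leadingCoeff_ne_zero.mpr hA0
  have hdeg : B.natDegree < A.natDegree := by omega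
  have hθden : ((theta A B).den : ℤ) ≠ 0 := by exact_mod_cast (theta A B).den_nz
  have hell : ell A B ≠ 0 := mul_ne_zero ha hθden
  obtain ⟨Tst, Nst, C₀, C₁, hC₀, hC₁, hT0, hNst2, hpd⟩ := point_data A B hB he hAB C
  -- the finite Ridout set (Step 5)
  set T : Finset (PadicAlgCl 2) := Polynomial.nthRootsFinset (gap A B) (gam A B : PadicAlgCl 2) with hT_def
  have halg : ∀ ζ ∈ T, IsAlgebraic ℚ ζ := by
    intro ζ hζ
    rw [hT_def, Polynomial.mem_nthRootsFinset (by omega)] at hζ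
    refine ⟨X ^ gap A B - Polynomial.C (gam A B), Polynomial.X_pow_sub_C_ne_zero (by omega) _, ?_⟩
    simp [hζ]
  have hfin := ridout_step T halg (ell A B) (ρ := 3 / 2) (C₀ := C₀) (C₁ := C₁) (by norm_num) hC₀ hC₁
  -- small points
  have hF := small_points_finite A.leadingCoeff ha C Tst
  -- fibres of `Z` (Step 6)
  let Fib : ℤ → Set ℕ := fun Z => {N | Nst ≤ N ∧ ∃ r : ℚ, OnLevel A B N r ∧ Tst < padicValNat 2 r.den ∧
    (Z : ℚ) = ell A B * 2 ^ padicValNat 2 r.den * (r + theta A B)}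
  have hFib : ∀ Z, (Fib Z).Finite := by
    intro Z
    by_contra hinf
    have hS' : ∀ N ∈ Fib Z, ∃ t : ℕ, ((gap A B * t : ℕ) : ℤ) = ((N)! : ℕ) + kap A B ∧
        OnLevel A B N ((Z : ℚ) / ell A B / 2 ^ t - theta A B) := by
      rintro N ⟨hNN, r, hpt, hTt, hZ⟩
      refine ⟨padicValNat 2 r.den, ?_, ?_⟩
      · exact val_relation A B hdeg (by omega) hpt (onLevel_A_ne_zero hAB hpt) (onLevel_B_ne_zero hAB hpt)
          (by omega)
      · have hellQ : (ell A B : ℚ) ≠ 0 := by exact_mod_cast hell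
        have hr : (Z : ℚ) / ell A B / 2 ^ padicValNat 2 r.den - theta A B = r := by
          rw [hZ]; field_simp; ring
        rw [hr]; exact hpt
    obtain ⟨hAθ, hBθ⟩ := common_root_of_fixed_value A B ((Z : ℚ) / ell A B) (theta A B) (e := gap A B) (by omega) (kap A B)
      (Fib Z) hinf hS'
    exact hAB _ hAθ hBθ
  -- the cover
  refine Set.Finite.subset (((Set.finite_lt_nat Nst).union
    (hF.biUnion fun r _ => levels_of_point_finite hAB r)).union (hfin.biUnion fun Z _ => hFib Z)) ?_
  rintro N ⟨r, hrC, hbev⟩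
  have hpt := onLevel_of_bev hbev
  by_cases hN : N < Nst
  · exact Or.inl (Or.inl hN)
  by_cases ht : padicValNat 2 r.den ≤ Tst
  · refine Or.inl (Or.inr ?_)
    simp only [Set.mem_iUnion]
    exact ⟨r, ⟨hrC, den_dvd_lc_two_pow A B hdeg hpt, ht⟩, hpt⟩
  · obtain ⟨Z, hZQ, hZR, ζ, hζe, hζ⟩ := hpd N (by omega) r hrC hpt (by omega)
    refine Or.inr ?_
    simp only [Set.mem_iUnion]
    refine ⟨Z, ⟨padicValNat 2 r.den, hZR, ζ, ?_, hζ⟩, (by omega : Nst ≤ N), r, hpt, by omega, hZQ⟩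
    rw [hT_def, Polynomial.mem_nthRootsFinset (by omega)]
    exact hζe

/-- **The x-linear thin fibre, gap `e ≥ 2`** — the clause holds at EVERY `m₀`. -/
theorem thinFibreAt_xLinP (A B : ℤ[X]) (hB : B ≠ 0) (he : B.natDegree + 2 ≤ A.natDegree)
    (hAB : ∀ r : ℚ, aeval r A = 0 → aeval r B = 0 → False) (m₀ : ℕ) : ThinFibreAt m₀ (xLinP A B) := by
  intro C
  obtain ⟨N₀, hN₀⟩ := (levels_finite A B hB he hAB C).bddAbove
  refine ⟨N₀ + 1, fun N hN r hr hP _ => ?_⟩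
  exact absurd (hN₀ ⟨r, hr, hP⟩) (by omega)

end Summit.Schanuel.Schanuel.Theorems.RootDecomp1KXLinear

end
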